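import Mathlib.LinearAlgebra.CrossProduct
import Mathlib.Analysis.Calculus.DifferentialForm.Basic
import Mathlib.Analysis.Calculus.FDeriv.Bilinear
import Mathlib.Analysis.Calculus.Deriv.Mul
import Mathlib.Analysis.Calculus.Deriv.Comp
import Mathlib.Analysis.Calculus.Deriv.Pi
import Mathlib.Analysis.Calculus.Deriv.Prod
import Mathlib.Analysis.Calculus.Deriv.Add
import Mathlib.Analysis.InnerProductSpace.PiL2
import Literature.Geometry.Lorentzian.CoordCurvature
import HarnessLib

/-!
# The minimal-coupling form of an `so(3)`-connection on an open set: the local model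
(topic `Geometry/Riemannian`; support for `exists_twistorSpace`, `TwistorPackage.lean`)

The chart model of the coupling 2-form of the twistor space (Fine–Panov 2009, Prop. 2.1;
Fine–Krasnov–Panov 2014, §4.1). Data: a finite-dimensional real normed space `E` (the chart) and
a connection form `c : E → (E →L[ℝ] ℝ³)` of the trivial `SO(3)`-bundle, `ℝ³ ≅ so(3)` acting by
the cross product (the connection of `Λ⁺` read in a positive orthonormal frame). We define

* `modelCurv c y u v = (D_u c)(v) - (D_v c)(u) + c(u) × c(v)` — the curvature vector
  `F = dc + c × c`;
* on `E × ℝ³` (coordinates `(y, η)`), `modelTheta c (y, η) (u, w) = w + c_y(u) × η` — the covariant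
  differential `θ = dη + c × η` of the tautological section — and the **coupling scalar**
  `modelScalar c (y, η) X₁ X₂ = (2π)⁻¹ (⟨η, θ(X₁) × θ(X₂)⟩ - |η|² ⟨η, F_y(u₁, u₂)⟩)`, an
  antisymmetric bilinear form in `X₁, X₂`, packaged as the continuous alternating 2-form
  `modelForm c : E × ℝ³ → (E × ℝ³) [⋀^Fin 2]→L[ℝ] ℝ` (on the unit sphere `|η| = 1` this is the
  printed coupling form; the factor `|η|²` makes the closedness below hold at every `η`);

and prove: `modelForm c` is `C^∞` where `c` is (`contDiffOn_modelForm`), and **its exterior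
derivative vanishes on triples of vectors tangent to `E × S²`**
(`extDeriv_modelForm_apply_eq_zero`: at `(y, η)`, on `Xᵢ = (uᵢ, wᵢ)` with `wᵢ ⊥ η`, `|η| = 1`) —
the computation `dω = 0` of Fine–Panov 2009, Prop. 2.1 / Reznikov 1993: with `θ = dη + c × η`,
`∇θ = F × η`, the Bianchi identity `dF + c × F = 0` and `⟨θ, η⟩ = 0`, both
`d⟨η, θ × θ⟩/2` and `d(|η|²⟨η, F⟩)` equal `|η|² ⟨F ∧ θ⟩` on tangent triples. The directional
derivatives are computed along lines (`fderiv f p X = (f ∘ line)'(0)`), and the final identity is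
a polynomial identity in the values and first two derivatives of `c` (closed by `ring`).

Everything here is proved; no named facts are introduced.

## References

* J. Fine, D. Panov, *Symplectic Calabi–Yau manifolds, minimal surfaces and the hyperbolic
  geometry of the conifold*, J. Differential Geom. 82 (2009), Prop. 2.1. [FinePanov2009]
* J. Fine, K. Krasnov, D. Panov, *A gauge theoretic approach to Einstein 4-manifolds*,
  New York J. Math. 20 (2014), §4.1. [FineKrasnovPanov2014]
* A. G. Reznikov, *Symplectic twistor spaces*, Ann. Global Anal. Geom. 11 (1993). [Reznikov1993]
-/

noncomputable section

open scoped Matrix BigOperators Topology ContDiff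
open Set Filter Function

namespace Literature.Geometry.Riemannian

/-- Local notation: `ℝ³` as coordinate vectors (where `crossProduct` and `dotProduct` live). -/
local notation "R3" => (Fin 3 → ℝ)
/-- Local notation: Euclidean `ℝ³`, the ambient space of the fibre sphere. -/
local notation "E3" => EuclideanSpace ℝ (Fin 3)
/-- Local notation for the cross product. -/
local infixl:74 " ×₃ " => crossProduct

/-! ### Antisymmetric bilinear forms as continuous alternating 2-maps -/

section Alt

variable {V : Type*} [NormedAddCommGroup V] [NormedSpace ℝ V]

omit [NormedAddCommGroup V] [NormedSpace ℝ V] in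
/-- Every `v : Fin 2 → V` is `![v 0, v 1]`. [folklore] -/
theorem eq_vecCons_two (v : Fin 2 → V) : v = ![v 0, v 1] := by
  funext i; fin_cases i <;> rfl

omit [NormedAddCommGroup V] [NormedSpace ℝ V] in
/-- Every `v : Fin 3 → V` is `![v 0, v 1, v 2]`. [folklore] -/
theorem eq_vecCons_three (v : Fin 3 → V) : v = ![v 0, v 1, v 2] := by
  funext i; fin_cases i <;> rfl

/-- The continuous alternating 2-map `(v, w) ↦ ½ (B(v, w) - B(w, v))` of a continuous bilinear form
(`= B(v, w)` for antisymmetric `B`); the construction of `couplingAlt` in `TwistorPackage.lean`.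
[folklore] -/
def altOfBilin (B : V →L[ℝ] V →L[ℝ] ℝ) : V [⋀^Fin 2]→L[ℝ] ℝ :=
  (2⁻¹ : ℝ) • ContinuousMultilinearMap.alternatization
    (ContinuousLinearMap.uncurryLeft
      (((continuousMultilinearCurryFin1 ℝ V ℝ).symm : (V →L[ℝ] ℝ) →L[ℝ] _).comp B))

/-- `altOfBilin B (v, w) = ½ (B v w - B w v)`. [folklore] -/
theorem altOfBilin_apply (B : V →L[ℝ] V →L[ℝ] ℝ) (v w : V) :
    altOfBilin B ![v, w] = 2⁻¹ * (B v w - B w v) := by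
  change (((2⁻¹ : ℝ) • ContinuousMultilinearMap.alternatization _ : V [⋀^Fin 2]→L[ℝ] ℝ))
    (show Fin 2 → V from ![v, w]) = _
  rw [ContinuousAlternatingMap.smul_apply, ContinuousMultilinearMap.alternatization_apply_apply]
  have huniv : (Finset.univ : Finset (Equiv.Perm (Fin 2))) = {1, Equiv.swap 0 1} := by decide
  rw [huniv, Finset.sum_pair (by decide)]
  simp [Equiv.Perm.sign_swap', Units.smul_def, sub_eq_add_neg]

/-- `altOfBilin` is additive. [folklore] -/
theorem altOfBilin_add (B B' : V →L[ℝ] V →L[ℝ] ℝ) :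
    altOfBilin (B + B') = altOfBilin B + altOfBilin B' := by
  ext v
  rw [eq_vecCons_two v, ContinuousAlternatingMap.add_apply, altOfBilin_apply, altOfBilin_apply,
    altOfBilin_apply]
  simp only [_root_.add_apply]
  ring

/-- `altOfBilin` is homogeneous. [folklore] -/
theorem altOfBilin_smul (r : ℝ) (B : V →L[ℝ] V →L[ℝ] ℝ) :
    altOfBilin (r • B) = r • altOfBilin B := by
  ext v
  rw [eq_vecCons_two v, ContinuousAlternatingMap.smul_apply, altOfBilin_apply, altOfBilin_apply]
  simp only [_root_.smul_apply, smul_eq_mul]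
  ring

variable [FiniteDimensional ℝ V]

/-- `altOfBilin` as a linear map. [folklore] -/
def altOfBilinₗ : (V →L[ℝ] V →L[ℝ] ℝ) →ₗ[ℝ] (V [⋀^Fin 2]→L[ℝ] ℝ) where
  toFun := altOfBilin
  map_add' := altOfBilin_add
  map_smul' := altOfBilin_smul

/-- `altOfBilin` as a continuous linear map (finite dimension). [folklore] -/
def altOfBilinCLM : (V →L[ℝ] V →L[ℝ] ℝ) →L[ℝ] (V [⋀^Fin 2]→L[ℝ] ℝ) :=
  LinearMap.toContinuousLinearMap (𝕜 := ℝ) (E := V →L[ℝ] V →L[ℝ] ℝ) altOfBilinₗ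

/-- `altOfBilinCLM` is `altOfBilin`. [folklore] -/
@[simp] theorem altOfBilinCLM_apply (B : V →L[ℝ] V →L[ℝ] ℝ) : altOfBilinCLM B = altOfBilin B := rfl

end Alt

/-! ### Calculus of the cross and dot products along curves -/

section CrossDot

/-- Product rule for the cross product along a curve. [folklore] -/
theorem hasDerivAt_crossProduct {f g : ℝ → R3} {f' g' : R3} {t : ℝ} (hf : HasDerivAt f f' t)
    (hg : HasDerivAt g g' t) :
    HasDerivAt (fun s ↦ f s ×₃ g s) (f' ×₃ g t + f t ×₃ g') t := by
  rw [hasDerivAt_pi] at hf hg ⊢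
  intro i
  fin_cases i
  · have h := ((hf 1).mul (hg 2)).sub ((hf 2).mul (hg 1))
    convert h using 1
    · funext s; simp [cross_apply]
    · simp [cross_apply]; ring
  · have h := ((hf 2).mul (hg 0)).sub ((hf 0).mul (hg 2))
    convert h using 1
    · funext s; simp [cross_apply]
    · simp [cross_apply]; ring
  · have h := ((hf 0).mul (hg 1)).sub ((hf 1).mul (hg 0))
    convert h using 1
    · funext s; simp [cross_apply]
    · simp [cross_apply]; ring

/-- Product rule for the dot product along a curve. [folklore] -/
theorem hasDerivAt_dotProduct {f g : ℝ → R3} {f' g' : R3} {t : ℝ} (hf : HasDerivAt f f' t)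
    (hg : HasDerivAt g g' t) :
    HasDerivAt (fun s ↦ f s ⬝ᵥ g s) (f' ⬝ᵥ g t + f t ⬝ᵥ g') t := by
  rw [hasDerivAt_pi] at hf hg
  have h : HasDerivAt (fun s ↦ ∑ i, f s i * g s i) (∑ i, (f' i * g t i + f t i * g' i)) t :=
    HasDerivAt.fun_sum fun i _ ↦ (hf i).mul (hg i)
  have h1 : (fun s ↦ f s ⬝ᵥ g s) = fun s ↦ ∑ i, f s i * g s i := rfl
  have h2 : f' ⬝ᵥ g t + f t ⬝ᵥ g' = ∑ i, (f' i * g t i + f t i * g' i) := by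
    simp only [dotProduct, ← Finset.sum_add_distrib]
  rw [h1, h2]
  exact h

end CrossDot

/-! ### The model: curvature vector, tautological differential, coupling scalar -/

section Model

variable {E : Type*} [NormedAddCommGroup E] [NormedSpace ℝ E]
  (c : E → E →L[ℝ] R3)

/-- **The curvature vector `F = dc + c × c`** of the connection form `c`:
`F_y(u, v) = (D_u c)_y(v) - (D_v c)_y(u) + c_y(u) × c_y(v)`. [cite: FinePanov2009, §2.1] -/
def modelCurv (y : E) (u v : E) : R3 :=
  fderiv ℝ c y u v - fderiv ℝ c y v u + c y u ×₃ c y v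

/-- `F(v, u) = -F(u, v)`. [folklore] -/
theorem modelCurv_swap (y : E) (u v : E) : modelCurv c y v u = -modelCurv c y u v := by
  simp only [modelCurv]
  rw [← cross_anticomm (c y u) (c y v)]
  abel

/-- `F` is additive in its first slot. [folklore] -/
theorem modelCurv_add_left (y : E) (u u' v : E) :
    modelCurv c y (u + u') v = modelCurv c y u v + modelCurv c y u' v := by
  simp only [modelCurv, map_add, _root_.add_apply, LinearMap.add_apply]
  abel

/-- `F` is homogeneous in its first slot. [folklore] -/
theorem modelCurv_smul_left (y : E) (r : ℝ) (u v : E) :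
    modelCurv c y (r • u) v = r • modelCurv c y u v := by
  simp only [modelCurv, map_smul, _root_.smul_apply, LinearMap.smul_apply, smul_sub,
    smul_add]

/-- **The covariant differential `θ = dη + c × η` of the tautological section** at
`p = (y, η) ∈ E × ℝ³` on the vector `X = (u, w)`: `θ(X) = w + c_y(u) × η`.
[cite: FinePanov2009, §2.1, Prop. 2.1] -/
def modelTheta (p : E × E3) (X : E × E3) : R3 :=
  WithLp.ofLp X.2 + c p.1 X.1 ×₃ WithLp.ofLp p.2

/-- `θ` is additive. [folklore] -/
theorem modelTheta_add (p : E × E3) (X X' : E × E3) :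
    modelTheta c p (X + X') = modelTheta c p X + modelTheta c p X' := by
  simp only [modelTheta, Prod.fst_add, Prod.snd_add, WithLp.ofLp_add, map_add,
    LinearMap.add_apply]
  abel

/-- `θ` is homogeneous. [folklore] -/
theorem modelTheta_smul (p : E × E3) (r : ℝ) (X : E × E3) :
    modelTheta c p (r • X) = r • modelTheta c p X := by
  simp only [modelTheta, Prod.smul_fst, Prod.smul_snd, WithLp.ofLp_smul, map_smul,
    LinearMap.smul_apply, smul_add]

/-- **The coupling scalar** at `p = (y, η)`:
`(2π)⁻¹ (⟨η, θ(X₁) × θ(X₂)⟩ - |η|² ⟨η, F_y(u₁, u₂)⟩)` — on `|η| = 1` the minimal-coupling form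
of Fine–Panov 2009, Prop. 2.1 (area form of the fibre on vertical vectors, `-(2π)⁻¹⟨η, F⟩` on
horizontal ones). [cite: FinePanov2009, Prop. 2.1] -/
def modelScalar (p : E × E3) (X₁ X₂ : E × E3) : ℝ :=
  (2 * Real.pi)⁻¹ *
    (WithLp.ofLp p.2 ⬝ᵥ (modelTheta c p X₁ ×₃ modelTheta c p X₂) -
      (WithLp.ofLp p.2 ⬝ᵥ WithLp.ofLp p.2) * (WithLp.ofLp p.2 ⬝ᵥ modelCurv c p.1 X₁.1 X₂.1))

/-- The coupling scalar is antisymmetric. [cite: FinePanov2009, Prop. 2.1] -/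
theorem modelScalar_swap (p : E × E3) (X₁ X₂ : E × E3) :
    modelScalar c p X₂ X₁ = -modelScalar c p X₁ X₂ := by
  simp only [modelScalar]
  rw [modelCurv_swap, ← cross_anticomm (modelTheta c p X₁), dotProduct_neg, dotProduct_neg]
  ring

/-- The coupling scalar is additive in its first slot. [folklore] -/
theorem modelScalar_add_left (p : E × E3) (X₁ X₁' X₂ : E × E3) :
    modelScalar c p (X₁ + X₁') X₂ = modelScalar c p X₁ X₂ + modelScalar c p X₁' X₂ := by
  simp only [modelScalar, modelTheta_add, Prod.fst_add, modelCurv_add_left, map_add,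
    LinearMap.add_apply, dotProduct_add]
  ring

/-- The coupling scalar is homogeneous in its first slot. [folklore] -/
theorem modelScalar_smul_left (p : E × E3) (r : ℝ) (X₁ X₂ : E × E3) :
    modelScalar c p (r • X₁) X₂ = r * modelScalar c p X₁ X₂ := by
  simp only [modelScalar, modelTheta_smul, Prod.smul_fst, modelCurv_smul_left, map_smul,
    LinearMap.smul_apply, dotProduct_smul, smul_eq_mul]
  ring

/-- The coupling scalar is additive in its second slot. [folklore] -/
theorem modelScalar_add_right (p : E × E3) (X₁ X₂ X₂' : E × E3) :
    modelScalar c p X₁ (X₂ + X₂') = modelScalar c p X₁ X₂ + modelScalar c p X₁ X₂' := by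
  rw [modelScalar_swap, modelScalar_add_left, modelScalar_swap c p X₂, modelScalar_swap c p X₂']
  ring

/-- The coupling scalar is homogeneous in its second slot. [folklore] -/
theorem modelScalar_smul_right (p : E × E3) (r : ℝ) (X₁ X₂ : E × E3) :
    modelScalar c p X₁ (r • X₂) = r * modelScalar c p X₁ X₂ := by
  rw [modelScalar_swap, modelScalar_smul_left, modelScalar_swap c p X₂]
  ring

variable [FiniteDimensional ℝ E]

/-- The coupling scalar as a continuous bilinear form on `E × ℝ³`. [cite: FinePanov2009, Prop. 2.1] -/
def modelBilin (p : E × E3) : (E × E3) →L[ℝ] (E × E3) →L[ℝ] ℝ :=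
  Literature.Geometry.Lorentzian.MetricCoord.mkCLM₂ (modelScalar c p) (modelScalar_add_left c p)
    (modelScalar_smul_left c p) (modelScalar_add_right c p) (modelScalar_smul_right c p)

/-- `modelBilin` is `modelScalar`. [folklore] -/
@[simp] theorem modelBilin_apply (p : E × E3) (X₁ X₂ : E × E3) :
    modelBilin c p X₁ X₂ = modelScalar c p X₁ X₂ := rfl

/-- **The model coupling 2-form** on `E × ℝ³`: the continuous alternating 2-map of the coupling
scalar. [cite: FinePanov2009, Prop. 2.1] -/
def modelForm (p : E × E3) : (E × E3) [⋀^Fin 2]→L[ℝ] ℝ :=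
  altOfBilin (modelBilin c p)

/-- `modelForm c p (X₁, X₂) = modelScalar c p X₁ X₂`. [cite: FinePanov2009, Prop. 2.1] -/
theorem modelForm_apply (p : E × E3) (X₁ X₂ : E × E3) :
    modelForm c p ![X₁, X₂] = modelScalar c p X₁ X₂ := by
  rw [modelForm, altOfBilin_apply, modelBilin_apply, modelBilin_apply, modelScalar_swap]
  ring

/-- `modelForm c p v = modelScalar c p (v 0) (v 1)`. [folklore] -/
theorem modelForm_apply' (p : E × E3) (v : Fin 2 → E × E3) :
    modelForm c p v = modelScalar c p (v 0) (v 1) := by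
  rw [eq_vecCons_two v, modelForm_apply]
  rfl

/-! ### Smoothness -/

omit [FiniteDimensional ℝ E] in
/-- `ofLp` on the second factor is smooth. [folklore] -/
theorem contDiff_ofLp_snd : ContDiff ℝ ∞ (fun p : E × E3 ↦ WithLp.ofLp p.2) := by
  have h : ContDiff ℝ ∞ (fun v : E3 ↦ WithLp.ofLp v) := (EuclideanSpace.equiv (Fin 3) ℝ).contDiff
  exact h.comp contDiff_snd

/-- The cross product of two smooth `ℝ³`-valued maps is smooth. [folklore] -/
theorem contDiffOn_cross {X : Type*} [NormedAddCommGroup X] [NormedSpace ℝ X] {f g : X → R3}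
    {s : Set X} {n : ℕ∞ω} (hf : ContDiffOn ℝ n f s) (hg : ContDiffOn ℝ n g s) :
    ContDiffOn ℝ n (fun x ↦ f x ×₃ g x) s := by
  rw [contDiffOn_pi] at hf hg ⊢
  intro i
  fin_cases i
  · have h := ((hf 1).mul (hg 2)).sub ((hf 2).mul (hg 1))
    exact h.congr fun x _ ↦ by simp [cross_apply]
  · have h := ((hf 2).mul (hg 0)).sub ((hf 0).mul (hg 2))
    exact h.congr fun x _ ↦ by simp [cross_apply]
  · have h := ((hf 0).mul (hg 1)).sub ((hf 1).mul (hg 0))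
    exact h.congr fun x _ ↦ by simp [cross_apply]

/-- The dot product of two smooth `ℝ³`-valued maps is smooth. [folklore] -/
theorem contDiffOn_dot {X : Type*} [NormedAddCommGroup X] [NormedSpace ℝ X] {f g : X → R3}
    {s : Set X} {n : ℕ∞ω} (hf : ContDiffOn ℝ n f s) (hg : ContDiffOn ℝ n g s) :
    ContDiffOn ℝ n (fun x ↦ f x ⬝ᵥ g x) s := by
  rw [contDiffOn_pi] at hf hg
  have h : ContDiffOn ℝ n (fun x ↦ ∑ i, f x i * g x i) s := ContDiffOn.sum fun i _ ↦ (hf i).mul (hg i)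
  exact h

variable {c} {V : Set E}

omit [FiniteDimensional ℝ E] in
/-- `p ↦ c_{p.1}(u)` is smooth on `V × ℝ³`. [folklore] -/
theorem contDiffOn_apply_fst (hc : ContDiffOn ℝ ∞ c V) (u : E) :
    ContDiffOn ℝ ∞ (fun p : E × E3 ↦ c p.1 u) (V ×ˢ (univ : Set E3)) :=
  ((hc.comp contDiffOn_fst fun _ hp ↦ hp.1).clm_apply contDiffOn_const)

omit [FiniteDimensional ℝ E] in
/-- `p ↦ (D c)_{p.1}(u)(v)` is smooth on `V × ℝ³` for `V` open. [folklore] -/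
theorem contDiffOn_fderiv_apply_fst (hV : IsOpen V) (hc : ContDiffOn ℝ ∞ c V) (u v : E) :
    ContDiffOn ℝ ∞ (fun p : E × E3 ↦ fderiv ℝ c p.1 u v) (V ×ˢ (univ : Set E3)) := by
  have h1 : ContDiffOn ℝ ∞ (fderiv ℝ c) V := hc.fderiv_of_isOpen (m := ∞) hV (le_of_eq rfl)
  exact (((h1.comp contDiffOn_fst fun p hp ↦ hp.1).clm_apply contDiffOn_const).clm_apply
    contDiffOn_const)

omit [FiniteDimensional ℝ E] in
/-- The tautological differential is smooth on `V × ℝ³`. [folklore] -/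
theorem contDiffOn_modelTheta (hc : ContDiffOn ℝ ∞ c V) (X : E × E3) :
    ContDiffOn ℝ ∞ (fun p : E × E3 ↦ modelTheta c p X) (V ×ˢ (univ : Set E3)) :=
  contDiffOn_const.add (contDiffOn_cross (contDiffOn_apply_fst hc X.1) contDiff_ofLp_snd.contDiffOn)

omit [FiniteDimensional ℝ E] in
/-- The curvature vector is smooth on `V × ℝ³` for `V` open. [folklore] -/
theorem contDiffOn_modelCurv (hV : IsOpen V) (hc : ContDiffOn ℝ ∞ c V) (u v : E) :
    ContDiffOn ℝ ∞ (fun p : E × E3 ↦ modelCurv c p.1 u v) (V ×ˢ (univ : Set E3)) :=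
  ((contDiffOn_fderiv_apply_fst hV hc u v).sub (contDiffOn_fderiv_apply_fst hV hc v u)).add
    (contDiffOn_cross (contDiffOn_apply_fst hc u) (contDiffOn_apply_fst hc v))

omit [FiniteDimensional ℝ E] in
/-- **The coupling scalar is smooth** on `V × ℝ³` (for fixed arguments). [folklore] -/
theorem contDiffOn_modelScalar (hV : IsOpen V) (hc : ContDiffOn ℝ ∞ c V) (X₁ X₂ : E × E3) :
    ContDiffOn ℝ ∞ (fun p : E × E3 ↦ modelScalar c p X₁ X₂) (V ×ˢ (univ : Set E3)) :=
  contDiffOn_const.mul ((contDiffOn_dot contDiff_ofLp_snd.contDiffOn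
    (contDiffOn_cross (contDiffOn_modelTheta hc X₁) (contDiffOn_modelTheta hc X₂))).sub
      ((contDiffOn_dot contDiff_ofLp_snd.contDiffOn contDiff_ofLp_snd.contDiffOn).mul
        (contDiffOn_dot contDiff_ofLp_snd.contDiffOn (contDiffOn_modelCurv hV hc X₁.1 X₂.1))))

/-- The coupling bilinear form is smooth on `V × ℝ³`. [folklore] -/
theorem contDiffOn_modelBilin (hV : IsOpen V) (hc : ContDiffOn ℝ ∞ c V) :
    ContDiffOn ℝ ∞ (modelBilin c) (V ×ˢ (univ : Set E3)) :=
  contDiffOn_clm_apply.2 fun X₁ ↦ contDiffOn_clm_apply.2 fun X₂ ↦ contDiffOn_modelScalar hV hc X₁ X₂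

variable (c) in
/-- The model form is `altOfBilinCLM ∘ modelBilin`. [folklore] -/
theorem modelForm_eq : modelForm c = fun p ↦ altOfBilinCLM (modelBilin c p) := rfl

/-- **The model coupling form is smooth** on `V × ℝ³`. [cite: FinePanov2009, Prop. 2.1] -/
theorem contDiffOn_modelForm (hV : IsOpen V) (hc : ContDiffOn ℝ ∞ c V) :
    ContDiffOn ℝ ∞ (modelForm c) (V ×ˢ (univ : Set E3)) := by
  rw [modelForm_eq]
  exact altOfBilinCLM.contDiff.comp_contDiffOn (contDiffOn_modelBilin hV hc)

/-- The model form is smooth at every point of `V × ℝ³`. [cite: FinePanov2009, Prop. 2.1] -/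
theorem contDiffAt_modelForm (hV : IsOpen V) (hc : ContDiffOn ℝ ∞ c V) {y : E} (hy : y ∈ V)
    (η : E3) : ContDiffAt ℝ ∞ (modelForm c) (y, η) :=
  (contDiffOn_modelForm hV hc).contDiffAt ((hV.prod isOpen_univ).mem_nhds ⟨hy, mem_univ _⟩)

/-! ### Directional derivatives along lines -/

omit [FiniteDimensional ℝ E] in
/-- The line `t ↦ x + t • v` has velocity `v`. [folklore] -/
theorem hasDerivAt_line {X : Type*} [NormedAddCommGroup X] [NormedSpace ℝ X] (x v : X) (t : ℝ) :
    HasDerivAt (fun s : ℝ ↦ x + s • v) v t := by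
  have h := ((hasDerivAt_id t).smul_const v).const_add x
  simpa using h

omit [FiniteDimensional ℝ E] in
/-- **The directional derivative as the derivative along a line**: if `f` is differentiable at
`x` and `t ↦ f (x + t v)` has derivative `d` at `0`, then `Df(x) v = d`. [folklore] -/
theorem fderiv_apply_eq_of_hasDerivAt_line {X : Type*} [NormedAddCommGroup X] [NormedSpace ℝ X]
    {F : Type*} [NormedAddCommGroup F] [NormedSpace ℝ F] {f : X → F} {x v : X} {d : F}
    (hf : DifferentiableAt ℝ f x) (hd : HasDerivAt (fun t : ℝ ↦ f (x + t • v)) d 0) :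
    fderiv ℝ f x v = d := by
  have h1 : HasDerivAt (fun t : ℝ ↦ f (x + t • v)) (fderiv ℝ f x v) 0 := by
    have hl := hasDerivAt_line x v 0
    have hf' : HasFDerivAt f (fderiv ℝ f x) (x + (0 : ℝ) • v) := by
      rw [zero_smul, add_zero]; exact hf.hasFDerivAt
    exact hf'.comp_hasDerivAt (0 : ℝ) hl
  exact h1.unique hd

omit [FiniteDimensional ℝ E] in
/-- `t ↦ c_{y + t u}(a)` has derivative `(D_u c)_y(a)` at `0`. [folklore] -/
theorem hasDerivAt_apply_line {y : E} (hcy : DifferentiableAt ℝ c y) (u a : E) :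
    HasDerivAt (fun t : ℝ ↦ c (y + t • u) a) (fderiv ℝ c y u a) 0 := by
  have h1 : HasFDerivAt (fun y' ↦ c y' a) ((fderiv ℝ c y).flip a) (y + (0 : ℝ) • u) := by
    rw [zero_smul, add_zero]
    exact Literature.Geometry.Lorentzian.MetricCoord.hasFDerivAt_clm_apply_const hcy.hasFDerivAt a
  have h2 := h1.comp_hasDerivAt (0 : ℝ) (hasDerivAt_line y u 0)
  simp only [ContinuousLinearMap.flip_apply] at h2
  exact h2

omit [FiniteDimensional ℝ E] in
/-- `t ↦ (D c)_{y + t u}(a)(b)` has derivative `(D² c)_y(u)(a)(b)` at `0`. [folklore] -/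
theorem hasDerivAt_fderiv_apply_line {y : E} (hcy : DifferentiableAt ℝ (fderiv ℝ c) y) (u a b : E) :
    HasDerivAt (fun t : ℝ ↦ fderiv ℝ c (y + t • u) a b) (fderiv ℝ (fderiv ℝ c) y u a b) 0 := by
  have h0 : HasFDerivAt (fun y' ↦ fderiv ℝ c y' a) ((fderiv ℝ (fderiv ℝ c) y).flip a) y :=
    Literature.Geometry.Lorentzian.MetricCoord.hasFDerivAt_clm_apply_const hcy.hasFDerivAt a
  have h1 : HasFDerivAt (fun y' ↦ fderiv ℝ c y' a b) (((fderiv ℝ (fderiv ℝ c) y).flip a).flip b)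
      (y + (0 : ℝ) • u) := by
    rw [zero_smul, add_zero]
    exact Literature.Geometry.Lorentzian.MetricCoord.hasFDerivAt_clm_apply_const h0 b
  have h2 := h1.comp_hasDerivAt (0 : ℝ) (hasDerivAt_line y u 0)
  simp only [ContinuousLinearMap.flip_apply] at h2
  exact h2

omit [FiniteDimensional ℝ E] in
/-- `t ↦ ofLp (η + t w) = ofLp η + t ofLp w` has derivative `ofLp w`. [folklore] -/
theorem hasDerivAt_ofLp_line (η w : E3) (t : ℝ) :
    HasDerivAt (fun s : ℝ ↦ WithLp.ofLp (η + s • w)) (WithLp.ofLp w) t := by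
  have h : (fun s : ℝ ↦ WithLp.ofLp (η + s • w)) = fun s ↦ WithLp.ofLp η + s • WithLp.ofLp w := by
    funext s; simp [WithLp.ofLp_add, WithLp.ofLp_smul]
  rw [h]
  exact hasDerivAt_line _ _ t

omit [FiniteDimensional ℝ E] in
/-- **The directional derivative of the coupling scalar.** At `p = (y, η)`, `y ∈ V`, in the
direction `C = (u, w)`, for fixed arguments `A, B`:
`D(modelScalar A B)(C) = (2π)⁻¹ (⟨w, θ_A × θ_B⟩ + ⟨η, θ_A' × θ_B + θ_A × θ_B'⟩
  - ((⟨w,η⟩ + ⟨η,w⟩) ⟨η, F_AB⟩ + |η|² (⟨w, F_AB⟩ + ⟨η, F_AB'⟩)))`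
with `θ_A' = (D_u c)(a) × η + c(a) × w` and
`F_AB' = D²c(u)(a)(b) - D²c(u)(b)(a) + (D_u c)(a) × c(b) + c(a) × (D_u c)(b)`. [folklore] -/
theorem fderiv_modelScalar_apply (hV : IsOpen V) (hc : ContDiffOn ℝ ∞ c V) {y : E} (hy : y ∈ V)
    (η : E3) (A B C : E × E3) :
    fderiv ℝ (fun p ↦ modelScalar c p A B) (y, η) C =
      (2 * Real.pi)⁻¹ *
        ((WithLp.ofLp C.2 ⬝ᵥ ((WithLp.ofLp A.2 + c y A.1 ×₃ WithLp.ofLp η) ×₃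
              (WithLp.ofLp B.2 + c y B.1 ×₃ WithLp.ofLp η)) +
            WithLp.ofLp η ⬝ᵥ
              ((fderiv ℝ c y C.1 A.1 ×₃ WithLp.ofLp η + c y A.1 ×₃ WithLp.ofLp C.2) ×₃
                  (WithLp.ofLp B.2 + c y B.1 ×₃ WithLp.ofLp η) +
                (WithLp.ofLp A.2 + c y A.1 ×₃ WithLp.ofLp η) ×₃
                  (fderiv ℝ c y C.1 B.1 ×₃ WithLp.ofLp η + c y B.1 ×₃ WithLp.ofLp C.2))) -
          ((WithLp.ofLp C.2 ⬝ᵥ WithLp.ofLp η + WithLp.ofLp η ⬝ᵥ WithLp.ofLp C.2) *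
              (WithLp.ofLp η ⬝ᵥ modelCurv c y A.1 B.1) +
            (WithLp.ofLp η ⬝ᵥ WithLp.ofLp η) *
              (WithLp.ofLp C.2 ⬝ᵥ modelCurv c y A.1 B.1 +
                WithLp.ofLp η ⬝ᵥ
                  (fderiv ℝ (fderiv ℝ c) y C.1 A.1 B.1 - fderiv ℝ (fderiv ℝ c) y C.1 B.1 A.1 +
                    (fderiv ℝ c y C.1 A.1 ×₃ c y B.1 + c y A.1 ×₃ fderiv ℝ c y C.1 B.1))))) := by
  -- differentiability of the scalar and of `c`, `Dc` at the point
  have hdiff : DifferentiableAt ℝ (fun p ↦ modelScalar c p A B) (y, η) :=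
    ((contDiffOn_modelScalar hV hc A B).contDiffAt
      ((hV.prod isOpen_univ).mem_nhds ⟨hy, mem_univ _⟩)).differentiableAt (by simp)
  have hcy : DifferentiableAt ℝ c y := ((hc y hy).contDiffAt (hV.mem_nhds hy)).differentiableAt (by simp)
  have hDcy : DifferentiableAt ℝ (fderiv ℝ c) y :=
    (((hc.fderiv_of_isOpen (m := ∞) hV (le_of_eq rfl)) y hy).contDiffAt (hV.mem_nhds hy)).differentiableAt (by simp)
  refine fderiv_apply_eq_of_hasDerivAt_line hdiff ?_
  -- the scalar along the line `t ↦ (y + t u, η + t w)`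
  have hline : (fun t : ℝ ↦ modelScalar c ((y, η) + t • C) A B) = fun t ↦
      (2 * Real.pi)⁻¹ *
        (WithLp.ofLp (η + t • C.2) ⬝ᵥ
            ((WithLp.ofLp A.2 + c (y + t • C.1) A.1 ×₃ WithLp.ofLp (η + t • C.2)) ×₃
              (WithLp.ofLp B.2 + c (y + t • C.1) B.1 ×₃ WithLp.ofLp (η + t • C.2))) -
          (WithLp.ofLp (η + t • C.2) ⬝ᵥ WithLp.ofLp (η + t • C.2)) *
            (WithLp.ofLp (η + t • C.2) ⬝ᵥ
              (fderiv ℝ c (y + t • C.1) A.1 B.1 - fderiv ℝ c (y + t • C.1) B.1 A.1 +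
                c (y + t • C.1) A.1 ×₃ c (y + t • C.1) B.1))) := by
    funext t
    rfl
  rw [hline]
  have hη := hasDerivAt_ofLp_line η C.2 0
  have hA' := hasDerivAt_apply_line hcy C.1 A.1
  have hB' := hasDerivAt_apply_line hcy C.1 B.1
  have hAB := hasDerivAt_fderiv_apply_line hDcy C.1 A.1 B.1
  have hBA := hasDerivAt_fderiv_apply_line hDcy C.1 B.1 A.1
  have hΘA := (hasDerivAt_crossProduct hA' hη).const_add (WithLp.ofLp A.2)
  have hΘB := (hasDerivAt_crossProduct hB' hη).const_add (WithLp.ofLp B.2)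
  have hF := (hAB.fun_sub hBA).fun_add (hasDerivAt_crossProduct hA' hB')
  have h := ((hasDerivAt_dotProduct hη (hasDerivAt_crossProduct hΘA hΘB)).fun_sub
    ((hasDerivAt_dotProduct hη hη).fun_mul (hasDerivAt_dotProduct hη hF))).const_mul (2 * Real.pi)⁻¹
  simp only [zero_smul, add_zero] at h
  exact h

/-! ### Closedness on tangent triples -/

omit [FiniteDimensional ℝ E] in
/-- A vector orthogonal to the unit vector `η` is `η × (w × η)`. [folklore] -/
theorem eq_cross_cross_of_dot_eq_zero {η w : R3} (hη : η ⬝ᵥ η = 1) (hw : η ⬝ᵥ w = 0) :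
    w = η ×₃ (w ×₃ η) := by
  rw [cross_cross_eq_smul_sub_smul', hη, one_smul, dotProduct_comm, hw, zero_smul, sub_zero]

omit [FiniteDimensional ℝ E] in
/-- Symmetry of the second derivative of the connection form at a point of `V`. [folklore] -/
theorem fderiv_fderiv_comm (hV : IsOpen V) (hc : ContDiffOn ℝ ∞ c V) {y : E} (hy : y ∈ V)
    (u v : E) : fderiv ℝ (fderiv ℝ c) y u v = fderiv ℝ (fderiv ℝ c) y v u := by
  have hr : minSmoothness ℝ 2 ≤ ∞ := by
    rw [minSmoothness_of_isRCLikeNormedField]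
    exact WithTop.coe_le_coe.2 le_top
  exact ((hc y hy).contDiffAt (hV.mem_nhds hy)).isSymmSndFDerivAt hr u v

/-- **The exterior derivative of the model coupling form vanishes on tangent triples**
(Fine–Panov 2009, Prop. 2.1: the coupling form is closed; Reznikov 1993). At `p = (y, η)` with
`y ∈ V`, `|η| = 1`, for vectors `Xᵢ = (uᵢ, wᵢ)` with `wᵢ ⊥ η` (tangent to `E × S²`),
`d(modelForm c)_p(X₀, X₁, X₂) = 0`. With `wᵢ = η × aᵢ` the three directional derivatives
(`fderiv_modelScalar_apply`) combine to a polynomial identity in `η, aᵢ, c(uᵢ), Dc(uᵢ)(uⱼ)` and the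
(symmetric) second derivatives of `c`, which `ring` verifies: the terms are
`d(½⟨η, θ ∧ θ⟩) = |η|²⟨F ∧ θ⟩` (using `θ ⊥ η`) and `d(|η|²⟨η, F⟩) = |η|²⟨θ ∧ F⟩` (Bianchi).
[cite: FinePanov2009, Prop. 2.1] -/
theorem extDeriv_modelForm_apply_eq_zero (hV : IsOpen V) (hc : ContDiffOn ℝ ∞ c V) {y : E}
    (hy : y ∈ V) {η : E3} (hη : WithLp.ofLp η ⬝ᵥ WithLp.ofLp η = 1) (X : Fin 3 → E × E3)
    (hX : ∀ i, WithLp.ofLp η ⬝ᵥ WithLp.ofLp (X i).2 = 0) :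
    extDeriv (modelForm c) (y, η) X = 0 := by
  have hdiff : DifferentiableAt ℝ (modelForm c) (y, η) :=
    (contDiffAt_modelForm hV hc hy η).differentiableAt (by simp)
  rw [extDeriv_apply hdiff, Fin.sum_univ_three]
  simp only [modelForm_apply']
  have r00 : Fin.removeNth (0 : Fin 3) X 0 = X 1 := rfl
  have r01 : Fin.removeNth (0 : Fin 3) X 1 = X 2 := rfl
  have r10 : Fin.removeNth (1 : Fin 3) X 0 = X 0 := rfl
  have r11 : Fin.removeNth (1 : Fin 3) X 1 = X 2 := rfl
  have r20 : Fin.removeNth (2 : Fin 3) X 0 = X 0 := rfl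
  have r21 : Fin.removeNth (2 : Fin 3) X 1 = X 1 := rfl
  simp only [r00, r01, r10, r11, r20, r21]
  rw [fderiv_modelScalar_apply hV hc hy η (X 1) (X 2) (X 0),
    fderiv_modelScalar_apply hV hc hy η (X 0) (X 2) (X 1),
    fderiv_modelScalar_apply hV hc hy η (X 0) (X 1) (X 2)]
  -- symmetrise the second derivatives
  rw [fderiv_fderiv_comm hV hc hy (X 1).1 (X 0).1, fderiv_fderiv_comm hV hc hy (X 2).1 (X 0).1,
    fderiv_fderiv_comm hV hc hy (X 2).1 (X 1).1]
  -- tangency: `wᵢ = η × (wᵢ × η)`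
  rw [eq_cross_cross_of_dot_eq_zero hη (hX 0), eq_cross_cross_of_dot_eq_zero hη (hX 1),
    eq_cross_cross_of_dot_eq_zero hη (hX 2)]
  generalize WithLp.ofLp (X 0).2 ×₃ WithLp.ofLp η = a₀
  generalize WithLp.ofLp (X 1).2 ×₃ WithLp.ofLp η = a₁
  generalize WithLp.ofLp (X 2).2 ×₃ WithLp.ofLp η = a₂
  simp only [modelCurv, Fin.val_zero, Fin.val_one, Fin.val_two, pow_zero, pow_one, one_smul,
    neg_smul, zsmul_eq_mul, Int.cast_pow, Int.cast_neg, Int.cast_one]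
  simp only [cross_apply, dotProduct, Fin.sum_univ_three, Matrix.cons_val_zero, Matrix.cons_val_one,
    Matrix.head_cons, Matrix.cons_val_two, Matrix.tail_cons, Pi.sub_apply, Pi.add_apply]
  ring

end Model

end Literature.Geometry.Riemannian
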